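import Summits.Ventures.PercRepro2.CaseOneRootsAndMark
import Summits.Ventures.PercRepro2.CaseOneRootsOnlyI

/-!
# The Q-threshold forms `(ii-Q)`, `(i-Q)` for the root-only class
(blind cell PercRepro2, p1 g17; S5 (S5.a″) (n) (5): the first missing face theorem)

The D-world induction of `CaseOneRootsOnly` / `CaseOneRootsOnlyI` works at EVERY threshold pair with
a nonnegative `c₁`: pinning an `a₁a₃`-edge adds a nonnegative BHK term (`iiExprD_a1_edge` +
`covDw_nonneg`, resp. `iExprD_a1_edge_of_root` + `covDwI_nonpos`), pinning an `a₂a₃`-edge scales by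
`(1 − p₂)²`, and with every edge at `a₃` null the D-world forms vanish. Hence
**`iiExprD_nonneg_of_rootsOnly`**, **`iExprD_nonneg_of_rootsOnly`**: `0 ≤ iiExprD p c₀ c₁`,
`0 ≤ iExprD p c₀ c₁` for every `c₀` and every `c₁ ≥ 0` when every edge at `a₃` joins a root. At the
Q pair `(P(Q, o ∈ U), P(Q))` the threshold condition of the one-line lemmas is `odds_q`
(BHK 1.4 + `{o ∈ C₂} ⊆ {o ∈ U}`, `CaseOneDWorldOdds`), so **`zSplitIIQ_of_rootsOnly`** and
**`zSplitIQ_of_rootsOnly`**: `(ii-Q)` and `(i-Q)` for the root-only class, every base, every weight.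
By the pendant lemma K8 (`zSplitII_of_leaf_at`) this closes `a₃` PENDANT at a root-only vertex on
both sides, and with `CaseOneGlued` it closes the `(ii-Q)` face `e(w–a₂) = 3` of the sister shape
uwa1. Own code; standard axioms. -/

namespace Summit.Ventures.PercRepro2

namespace CaseOne

section RootsOnlyQ
variable {V : Type*} {E : Type*} [Fintype E] [DecidableEq E] [Fintype V] [DecidableEq V]
  {R : Type*} [Field R] [LinearOrder R] [IsStrictOrderedRing R]
variable {ends : E → Sym2 V} {a₁ a₂ a₃ : V}

/-- **The D-world `(ii)` of the root-only class at every threshold pair with `c₁ ≥ 0`.** -/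
theorem iiExprD_nonneg_of_rootsOnly (p : E → R) (hp : IsProbVec p)
    (hroot : ∀ e, a₃ ∈ ends e → ends e = s(a₁, a₃) ∨ ends e = s(a₂, a₃)) (h1 : a₁ ≠ a₃)
    (o b : V) (c₀ c₁ : R) (hc₁ : 0 ≤ c₁) : 0 ≤ iiExprD p ends o a₁ a₂ a₃ b c₀ c₁ := by
  generalize hn : (liveAt p ends a₃).card = n
  induction n using Nat.strong_induction_on generalizing p with
  | _ n ih =>
    by_cases h0 : liveAt p ends a₃ = ∅
    · have hnull : ∀ e, a₃ ∈ ends e → p e = 0 := by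
        intro e he
        by_contra hc
        have : e ∈ liveAt p ends a₃ := by simp [liveAt, he, hc]
        rw [h0] at this
        exact absurd this (Finset.notMem_empty e)
      rw [iiExprD_eq_zero_of_null p hnull h1]
    · obtain ⟨e, he⟩ := Finset.nonempty_iff_ne_empty.mpr h0
      have he' : a₃ ∈ ends e := by
        have := he
        simp only [liveAt, Finset.mem_filter, Finset.mem_univ, true_and] at this
        exact this.1
      have hlt : ((liveAt p ends a₃).erase e).card < n := by
        rw [← hn]; exact Finset.card_erase_lt_of_mem he
      have hp0 : IsProbVec (Function.update p e 0) := hp.update e le_rfl zero_le_one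
      have hrec := ih _ hlt (Function.update p e 0) hp0 (by rw [liveAt_update])
      have hpe : 0 ≤ p e := hp.nonneg e
      have hpe' : 0 ≤ 1 - p e := sub_nonneg.2 (hp.le_one e)
      rcases hroot e he' with h | h
      · rw [iiExprD_a1_edge p h o b c₀ c₁]
        have hcov := covDw_nonneg (Function.update p e 0) hp0 ends o a₁ a₂ a₃ b
        exact add_nonneg (mul_nonneg (mul_nonneg hpe hc₁) hcov) (mul_nonneg hpe' hrec)
      · rw [iiExprD_a2_edge p h o b c₀ c₁]
        exact mul_nonneg (pow_nonneg hpe' 2) hrec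

/-- **The D-world `(i)` of the root-only class at every threshold pair with `c₁ ≥ 0`.** -/
theorem iExprD_nonneg_of_rootsOnly (p : E → R) (hp : IsProbVec p)
    (hroot : ∀ e, a₃ ∈ ends e → ends e = s(a₁, a₃) ∨ ends e = s(a₂, a₃)) (h1 : a₁ ≠ a₃)
    (o : V) {b : V} (hb : b ≠ a₃) (c₀ c₁ : R) (hc₁ : 0 ≤ c₁) :
    0 ≤ iExprD p ends o a₁ a₂ a₃ b c₀ c₁ := by
  generalize hn : (liveAt p ends a₃).card = n
  induction n using Nat.strong_induction_on generalizing p with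
  | _ n ih =>
    by_cases h0 : liveAt p ends a₃ = ∅
    · have hnull : ∀ e, a₃ ∈ ends e → p e = 0 := by
        intro e he
        by_contra hc
        have : e ∈ liveAt p ends a₃ := by simp [liveAt, he, hc]
        rw [h0] at this
        exact absurd this (Finset.notMem_empty e)
      rw [iExprD_eq_zero_of_null p hnull h1]
    · obtain ⟨e, he⟩ := Finset.nonempty_iff_ne_empty.mpr h0
      have he' : a₃ ∈ ends e := by
        have := he
        simp only [liveAt, Finset.mem_filter, Finset.mem_univ, true_and] at this
        exact this.1
      have hlt : ((liveAt p ends a₃).erase e).card < n := by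
        rw [← hn]; exact Finset.card_erase_lt_of_mem he
      have hp0 : IsProbVec (Function.update p e 0) := hp.update e le_rfl zero_le_one
      have hrec := ih _ hlt (Function.update p e 0) hp0 (by rw [liveAt_update])
      have hpe : 0 ≤ p e := hp.nonneg e
      have hpe' : 0 ≤ 1 - p e := sub_nonneg.2 (hp.le_one e)
      rcases hroot e he' with h | h
      · rw [iExprD_a1_edge_of_root p hroot h hb c₀ c₁]
        have hcov := covDwI_nonpos (Function.update p e 0) hp0 ends o a₁ a₂ a₃ b
        have t1 := mul_nonpos_of_nonneg_of_nonpos (mul_nonneg hpe hc₁) hcov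
        have t2 := mul_nonneg hpe' hrec
        linarith [t1, t2]
      · rw [iExprD_a2_edge p h o b c₀ c₁]
        exact mul_nonneg (pow_nonneg hpe' 2) hrec

/-- **`(ii-Q)` for the root-only class**: every edge at `a₃` joins a root (any multiplicities, any
weights). -/
theorem zSplitIIQ_of_rootsOnly (p : E → R) (hp : IsProbVec p)
    (hroot : ∀ e, a₃ ∈ ends e → ends e = s(a₁, a₃) ∨ ends e = s(a₂, a₃)) (h1 : a₁ ≠ a₃)
    (o b : V) : ZSplitIIQ p ends o a₁ a₂ a₃ b := by
  unfold ZSplitIIQ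
  exact iiExprT_nonneg_of_dworld p hp ends o a₁ a₂ a₃ b _ _
    (iiExprD_nonneg_of_rootsOnly p hp hroot h1 o b _ _ (prob_nonneg hp _))
    (odds_q p hp ends o a₁ a₂ a₃)

/-- **`(i-Q)` for the root-only class.** -/
theorem zSplitIQ_of_rootsOnly (p : E → R) (hp : IsProbVec p)
    (hroot : ∀ e, a₃ ∈ ends e → ends e = s(a₁, a₃) ∨ ends e = s(a₂, a₃)) (h1 : a₁ ≠ a₃)
    (o : V) {b : V} (hb : b ≠ a₃) : ZSplitIQ p ends o a₁ a₂ a₃ b := by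
  unfold ZSplitIQ
  exact iExprT_nonneg_of_dworld p hp ends o a₁ a₂ a₃ b _ _
    (iExprD_nonneg_of_rootsOnly p hp hroot h1 o hb _ _ (prob_nonneg hp _))
    (odds_q p hp ends o a₁ a₂ a₃)

end RootsOnlyQ

end CaseOne

end Summit.Ventures.PercRepro2
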